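import Summits.QuantumAdvantage.QuantumAdvantage.Theorems.CharDialJLinGroupFreeze
import Summits.QuantumAdvantage.QuantumAdvantage.Theorems.CharDialJLinHybrid
import HarnessLib

/-!
# Cell qa-qnc0 / decomp-qadv (odd primes): the GROUP-PEEL LAW — freezing a group of cuts costs its private code's weight enumerator

TREE-READY PART 8 of the node `HOME/decomp-qadv-lens-6/g10/CodeDial.lean` (§18), on top of part 7 (group freezing, code cost) and
part 4 (`CharDialJLinHybrid`: `winCount_eq_sum`, per-site contraction input; part 2's `UnreadTwist.unread_corr_win_le`).

**`group_peel`** (`p ≠ 3`, `ρ = cos(π/(3p))`): for all data `D` and every group `G` of cuts there is `κ` with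
`#win(D) ≤ 3·codeCost_ρ(D,G)·2ⁿ + #win(D.freezeAll G κ)`.  Proof: expand ALL `|G|` form values in additive characters at once
— `sum_tSet_char` (`Σ_t e(Σ_g t_g d_g) = p^|G|·[d|_G = 0]`, orthogonality on the group, the MacWilliams kernel) —, bound each
twisted correlation `Σ_u [win_(D.freezeAll G κ) u]·e(β_t·u)` by part 2's adaptive blind-set bound on the group-private bits where
`β_t ≠ 0` (`3·ρ^privWt(t)·2ⁿ`), and average over `κ` (`group_defect_le`).  `|G| = 1` is part 4's `hybrid_step`.
-/

noncomputable section

namespace Summit.QuantumAdvantage.AdviceFreeQNC0.JLinPeel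

open Finset Summit.QuantumAdvantage.AdviceFreeQNC0 TwistedTransfer

/-! ### §18 The GROUP-PEEL LAW: `#win(D) ≤ max_κ #win(D.freezeAll G κ) + 3·codeCost_ρ(D, G)·2ⁿ` — PROVED (`p ≠ 3`) -/

section GroupLaw

variable {p : ℕ} [Fact p.Prime] {n : ℕ}

open JLinData

/-- A character of a sum is the product of the characters. -/
theorem stdAddChar_sum_eq_prod (s : Finset (Fin (n + 1))) (f : Fin (n + 1) → ZMod p) :
    (ZMod.stdAddChar (∑ g ∈ s, f g) : ℂ) = ∏ g ∈ s, (ZMod.stdAddChar (f g) : ℂ) := by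
  classical
  induction s using Finset.induction_on with
  | empty => simp
  | insert a s ha ih => rw [Finset.sum_insert ha, Finset.prod_insert ha, AddChar.map_add_eq_mul, ih]

/-- **Orthogonality on the group**: `Σ_{t supported on G} e_p(Σ_{g ∈ G} t_g d_g) = p^{|G|}·[d ≡ 0 on G]`. -/
theorem sum_tSet_char (G : Finset (Fin (n + 1))) (d : Fin (n + 1) → ZMod p) :
    (∑ t ∈ tSet p G, (ZMod.stdAddChar (∑ g ∈ G, t g * d g) : ℂ)) =
      if (∀ g ∈ G, d g = 0) then ((p : ℂ) ^ G.card) else 0 := by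
  classical
  haveI : NeZero p := ⟨(Fact.out : p.Prime).ne_zero⟩
  -- each summand is a product over ALL cuts (the factors outside `G` are `e_p(0) = 1`)
  have hterm : ∀ t ∈ tSet p G, (ZMod.stdAddChar (∑ g ∈ G, t g * d g) : ℂ) =
      ∏ g : Fin (n + 1), (ZMod.stdAddChar (t g * d g) : ℂ) := by
    intro t ht
    rw [stdAddChar_sum_eq_prod]
    exact Finset.prod_subset (subset_univ G) fun g _ hg => by
      rw [mem_tSet.1 ht g hg, zero_mul, AddChar.map_zero_eq_one]
  rw [Finset.sum_congr rfl hterm]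
  unfold tSet
  rw [← Finset.prod_univ_sum (fun g => if g ∈ G then (univ : Finset (ZMod p)) else {0})
    (fun g x => (ZMod.stdAddChar (x * d g) : ℂ))]
  -- the factor of `g`: `p·[d g = 0]` inside `G`, `1` outside
  have hfac : ∀ g : Fin (n + 1), (∑ x ∈ (if g ∈ G then (univ : Finset (ZMod p)) else {0}),
      (ZMod.stdAddChar (x * d g) : ℂ)) = if g ∈ G then (if d g = 0 then (p : ℂ) else 0) else 1 := by
    intro g
    by_cases hg : g ∈ G
    · rw [if_pos hg, if_pos hg]
      have := Literature.Analysis.Fourier.sum_stdAddChar_mul (N := p) (d g)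
      rw [← this]
      exact Finset.sum_congr rfl fun x _ => by rw [mul_comm]
    · rw [if_neg hg, if_neg hg, sum_singleton, zero_mul, AddChar.map_zero_eq_one]
  rw [Finset.prod_congr rfl (fun g _ => hfac g)]
  by_cases hall : ∀ g ∈ G, d g = 0
  · rw [if_pos hall]
    have : ∀ g ∈ (univ : Finset (Fin (n + 1))), (if g ∈ G then (if d g = 0 then (p : ℂ) else 0) else 1) =
        if g ∈ G then (p : ℂ) else 1 := by
      intro g _
      by_cases hg : g ∈ G
      · rw [if_pos hg, if_pos hg, if_pos (hall g hg)]
      · rw [if_neg hg, if_neg hg]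
    rw [Finset.prod_congr rfl this, Finset.prod_ite, Finset.prod_const, Finset.prod_const_one, mul_one,
      Finset.filter_mem_eq_inter, Finset.univ_inter]
  · rw [if_neg hall]
    push Not at hall
    obtain ⟨g₀, hg₀, hd⟩ := hall
    exact Finset.prod_eq_zero (mem_univ g₀) (by rw [if_pos hg₀, if_neg hd])

/-- The group form sum as a bit sum against the twist vector: `Σ_{g∈G} t_g·ℓ_g(u) = Σ_{i : u_i} β_t(i)`. -/
theorem sum_mul_form_eq (D : JLinData p n) (G : Finset (Fin (n + 1))) (t : Fin (n + 1) → ZMod p) (u : Fin n → Bool) :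
    (∑ g ∈ G, t g * D.form g u) = ∑ i : Fin n, if u i then D.twistVec G t i else 0 := by
  unfold form twistVec
  simp_rw [Finset.mul_sum]
  rw [Finset.sum_comm]
  refine Finset.sum_congr rfl fun i _ => ?_
  by_cases hu : u i
  · simp [hu]
  · simp [hu]

/-- **The group defect bound**: `p^{|G|}·#win(D) − Σ_{κ on G} #win(D.freezeAll G κ) ≤ p^{|G|}·3·codeCost_ρ(D,G)·2ⁿ` —
pointwise coupling, orthogonality on `𝔽_p^G`, and the UNREAD twisted correlation bound (g9 §13) applied to each group-frozen
strategy, which is blind to the group-private bits; the twist of index `t` is `β_t = Σ_g t_g a_g`, alive exactly on the private bits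
where `β_t ≠ 0`. -/
theorem group_defect_le {ρ : ℝ} (hρ : 0 ≤ ρ)
    (hsite : ∀ a : ZMod p, a ≠ 0 → ∀ v : ZMod 3 → ℂ, cnsq (twAvg (ZMod.stdAddChar a) v) ≤ ρ ^ 2 * cnsq v)
    (c : ℕ) (D : JLinData p n) (G : Finset (Fin (n + 1))) :
    (p : ℝ) ^ G.card * (winCount c D.strat : ℝ) - ∑ κ ∈ tSet p G, (winCount c (D.freezeAll G κ).strat : ℝ) ≤
      (p : ℝ) ^ G.card * (3 * D.codeCost G ρ * (2 : ℝ) ^ n) := by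
  classical
  set W : (Fin (n + 1) → ZMod p) → (Fin n → Bool) → ℂ := fun κ u =>
    if ringWinU c (D.freezeAll G κ).strat u = true then (1 : ℂ) else 0 with hW
  set ψ : (Fin (n + 1) → ZMod p) → (Fin n → Bool) → (Fin (n + 1) → ZMod p) → ℂ := fun κ u t =>
    (ZMod.stdAddChar (∑ g ∈ G, t g * (D.form g u - κ g)) : ℂ) with hψ
  -- the matching residue vector of `u`
  set κs : (Fin n → Bool) → (Fin (n + 1) → ZMod p) := fun u g => if g ∈ G then D.form g u else 0 with hκs
  have hκs_mem : ∀ u, κs u ∈ tSet p G := fun u => mem_tSet.2 fun g hg => by rw [hκs]; simp only; rw [if_neg hg]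
  -- (1) coupling: `[win_D u] = Σ_{κ on G} [ℓ_G u = κ]·W κ u`
  have hcouple : ∀ u : Fin n → Bool, (if ringWinU c D.strat u = true then (1 : ℂ) else 0) =
      ∑ κ ∈ tSet p G, (if (∀ g ∈ G, D.form g u = κ g) then W κ u else 0) := by
    intro u
    rw [Finset.sum_eq_single_of_mem (κs u) (hκs_mem u)]
    · have hmatch : ∀ g ∈ G, D.form g u = κs u g := fun g hg => by rw [hκs]; simp only; rw [if_pos hg]
      rw [if_pos hmatch, hW]
      simp only
      rw [UnreadTwist.ringWinU_congr (y' := (D.freezeAll G (κs u)).strat)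
        (fun g' => (strat_freezeAll_match D G (κs u) u (fun g hg => (hmatch g hg).symm) g').symm)]
    · intro κ hκ hne
      rw [if_neg]
      intro hall
      apply hne
      funext g
      by_cases hg : g ∈ G
      · rw [← hall g hg, hκs]; simp only; rw [if_pos hg]
      · rw [mem_tSet.1 hκ g hg, hκs]; simp only; rw [if_neg hg]
  -- (2) orthogonality: `p^{|G|}·[ℓ_G u = κ]·W = Σ_t ψ κ u t · W`
  have horth : ∀ (u : Fin n → Bool) (κ : Fin (n + 1) → ZMod p),
      (p : ℂ) ^ G.card * (if (∀ g ∈ G, D.form g u = κ g) then W κ u else 0) = ∑ t ∈ tSet p G, ψ κ u t * W κ u := by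
    intro u κ
    rw [← Finset.sum_mul, hψ]
    simp only
    rw [sum_tSet_char G (fun g => D.form g u - κ g)]
    by_cases h : ∀ g ∈ G, D.form g u = κ g
    · rw [if_pos h, if_pos (fun g hg => sub_eq_zero.2 (h g hg))]
    · rw [if_neg h, if_neg (fun h' => h (fun g hg => sub_eq_zero.1 (h' g hg))), mul_zero, zero_mul]
  -- (3) the defect as a character sum over `t ≠ 0`
  have h0mem : (0 : Fin (n + 1) → ZMod p) ∈ tSet p G := zero_mem_tSet G
  have hdefect : ((p : ℂ) ^ G.card * ((winCount c D.strat : ℕ) : ℂ) -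
      ∑ κ ∈ tSet p G, ((winCount c (D.freezeAll G κ).strat : ℕ) : ℂ)) =
      ∑ κ ∈ tSet p G, ∑ t ∈ (tSet p G).erase 0, ∑ u : Fin n → Bool, ψ κ u t * W κ u := by
    have hA : (p : ℂ) ^ G.card * ((winCount c D.strat : ℕ) : ℂ) =
        ∑ u : Fin n → Bool, ∑ κ ∈ tSet p G, ∑ t ∈ tSet p G, ψ κ u t * W κ u := by
      rw [winCount_eq_sum, Finset.mul_sum]
      refine Finset.sum_congr rfl fun u _ => ?_
      rw [hcouple u, Finset.mul_sum]
      exact Finset.sum_congr rfl fun κ _ => horth u κ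
    have hB : (∑ κ ∈ tSet p G, ((winCount c (D.freezeAll G κ).strat : ℕ) : ℂ)) =
        ∑ u : Fin n → Bool, ∑ κ ∈ tSet p G, ψ κ u 0 * W κ u := by
      rw [Finset.sum_comm]
      refine Finset.sum_congr rfl fun κ _ => ?_
      rw [winCount_eq_sum]
      refine Finset.sum_congr rfl fun u _ => ?_
      rw [hψ, hW]
      simp
    rw [hA, hB, ← Finset.sum_sub_distrib]
    have hu : ∀ u : Fin n → Bool, ((∑ κ ∈ tSet p G, ∑ t ∈ tSet p G, ψ κ u t * W κ u) -
        ∑ κ ∈ tSet p G, ψ κ u 0 * W κ u) = ∑ κ ∈ tSet p G, ∑ t ∈ (tSet p G).erase 0, ψ κ u t * W κ u := by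
      intro u
      rw [← Finset.sum_sub_distrib]
      refine Finset.sum_congr rfl fun κ _ => ?_
      rw [Finset.sum_erase_eq_sub h0mem]
    rw [Finset.sum_congr rfl fun u _ => hu u, Finset.sum_comm]
    refine Finset.sum_congr rfl fun κ _ => ?_
    rw [Finset.sum_comm]
  -- (4) each inner `u`-sum is a twisted win sum of a strategy BLIND to the group-private bits
  have hinner : ∀ (κ t : Fin (n + 1) → ZMod p),
      ‖∑ u : Fin n → Bool, ψ κ u t * W κ u‖ ≤ 3 * ρ ^ D.privWt G t * (2 : ℝ) ^ n := by
    intro κ t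
    have hfac : ∀ u : Fin n → Bool, ψ κ u t * W κ u = (ZMod.stdAddChar (-(∑ g ∈ G, t g * κ g)) : ℂ) *
        (W κ u * (ZMod.stdAddChar (∑ i : Fin n, if u i then D.twistVec G t i else 0) : ℂ)) := by
      intro u
      rw [hψ]
      simp only
      have hsum : (∑ g ∈ G, t g * (D.form g u - κ g)) =
          (∑ i : Fin n, if u i then D.twistVec G t i else 0) + (-(∑ g ∈ G, t g * κ g)) := by
        rw [← sum_mul_form_eq D G t u, ← sub_eq_add_neg, ← Finset.sum_sub_distrib]
        exact Finset.sum_congr rfl fun g _ => by ring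
      rw [hsum, AddChar.map_add_eq_mul]
      ring
    rw [Finset.sum_congr rfl fun u _ => hfac u, ← Finset.mul_sum, norm_mul,
      show ‖(ZMod.stdAddChar (-(∑ g ∈ G, t g * κ g)) : ℂ)‖ = 1 from by
        rw [show (ZMod.stdAddChar (-(∑ g ∈ G, t g * κ g)) : ℂ) = (ZMod.toCircle (-(∑ g ∈ G, t g * κ g)) : ℂ) from rfl,
          Circle.norm_coe],
      one_mul]
    set P : Finset (Fin n) := (D.gPrivSet G).filter fun i => D.twistVec G t i ≠ 0 with hP
    have hPne : ∀ i ∈ P, D.twistVec G t i ≠ 0 := fun i hi => by rw [hP, mem_filter] at hi; exact hi.2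
    have hblind : ∀ g' (u v : Fin n → Bool), (∀ i : Fin n, i ∉ P → u i = v i) →
        (D.freezeAll G κ).strat g' u = (D.freezeAll G κ).strat g' v := by
      intro g' u v huv
      refine strat_freezeAll_blind D G κ g' u v fun i hi => huv i fun hiP => hi ?_
      rw [hP, mem_filter] at hiP
      exact hiP.1
    have key := UnreadTwist.unread_corr_win_le hρ hsite c (D.freezeAll G κ).strat (D.twistVec G t) P hPne hblind
    unfold privWt
    rw [hW]
    exact key
  -- (5) add up
  have hnorm : ‖(p : ℂ) ^ G.card * ((winCount c D.strat : ℕ) : ℂ) -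
      ∑ κ ∈ tSet p G, ((winCount c (D.freezeAll G κ).strat : ℕ) : ℂ)‖ ≤
      (p : ℝ) ^ G.card * (3 * D.codeCost G ρ * (2 : ℝ) ^ n) := by
    rw [hdefect]
    calc ‖∑ κ ∈ tSet p G, ∑ t ∈ (tSet p G).erase 0, ∑ u : Fin n → Bool, ψ κ u t * W κ u‖
        ≤ ∑ κ ∈ tSet p G, ‖∑ t ∈ (tSet p G).erase 0, ∑ u : Fin n → Bool, ψ κ u t * W κ u‖ := norm_sum_le _ _
      _ ≤ ∑ κ ∈ tSet p G, ∑ t ∈ (tSet p G).erase 0, ‖∑ u : Fin n → Bool, ψ κ u t * W κ u‖ :=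
          Finset.sum_le_sum fun κ _ => norm_sum_le _ _
      _ ≤ ∑ κ ∈ tSet p G, ∑ t ∈ (tSet p G).erase 0, (3 * ρ ^ D.privWt G t * (2 : ℝ) ^ n) :=
          Finset.sum_le_sum fun κ _ => Finset.sum_le_sum fun t _ => hinner κ t
      _ = (p : ℝ) ^ G.card * (3 * D.codeCost G ρ * (2 : ℝ) ^ n) := by
          rw [Finset.sum_const, card_tSet, nsmul_eq_mul]
          unfold codeCost
          rw [Nat.cast_pow]
          calc (p : ℝ) ^ G.card * ∑ t ∈ (tSet p G).erase 0, 3 * ρ ^ D.privWt G t * (2 : ℝ) ^ n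
              = (p : ℝ) ^ G.card * ∑ t ∈ (tSet p G).erase 0, (3 * (2 : ℝ) ^ n) * ρ ^ D.privWt G t := by
                congr 1; exact Finset.sum_congr rfl fun t _ => by ring
            _ = (p : ℝ) ^ G.card * (3 * (∑ t ∈ (tSet p G).erase 0, ρ ^ D.privWt G t) * (2 : ℝ) ^ n) := by
                rw [← Finset.mul_sum]; ring
  -- (6) back to `ℝ`
  have hcast : (p : ℂ) ^ G.card * ((winCount c D.strat : ℕ) : ℂ) -
      ∑ κ ∈ tSet p G, ((winCount c (D.freezeAll G κ).strat : ℕ) : ℂ) =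
      (((p : ℝ) ^ G.card * (winCount c D.strat : ℝ) -
        ∑ κ ∈ tSet p G, (winCount c (D.freezeAll G κ).strat : ℝ) : ℝ) : ℂ) := by
    push_cast
    ring
  have hre : (p : ℝ) ^ G.card * (winCount c D.strat : ℝ) - ∑ κ ∈ tSet p G, (winCount c (D.freezeAll G κ).strat : ℝ) ≤
      ‖(p : ℂ) ^ G.card * ((winCount c D.strat : ℕ) : ℂ) -
        ∑ κ ∈ tSet p G, ((winCount c (D.freezeAll G κ).strat : ℕ) : ℂ)‖ := by
    rw [hcast, Complex.norm_real, Real.norm_eq_abs]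
    exact le_abs_self _
  exact hre.trans hnorm

/-- The per-site contraction `cnsq (twAvg e_p(a) v) ≤ cos²(π/3p)·cnsq v` for `a ≠ 0`, `p ≠ 3` (qn-lit's
`TwoModuli.sum_norm_sq_twistStep_three_le`, exactly as inside part 4's `hybrid_step` and the tree's `twistBound`). -/
theorem site_contraction (hp3 : p ≠ 3) : ∀ a : ZMod p, a ≠ 0 → ∀ v : ZMod 3 → ℂ,
    cnsq (twAvg (ZMod.stdAddChar a) v) ≤ Real.cos (Real.pi / (3 * p)) ^ 2 * cnsq v := by
  have hcop : p.Coprime 3 := (Nat.coprime_primes (Fact.out : p.Prime) Nat.prime_three).2 hp3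
  intro a ha v
  have h := Literature.Computability.MetaComplexity.TwoModuli.sum_norm_sq_twistStep_three_le hcop ha 1 2
    (X := Unit) (fun sx => v sx.1)
  rw [Fintype.sum_prod_type, Fintype.sum_prod_type] at h
  simp only [Finset.sum_const, Finset.card_univ, Fintype.card_unit, one_smul] at h
  have hl : (∑ s : ZMod 3, ‖v (s + 1) + ZMod.stdAddChar a * v (s + 2)‖ ^ 2) =
      4 * cnsq (twAvg (ZMod.stdAddChar a) v) := by
    rw [show (∑ s : ZMod 3, ‖v (s + 1) + ZMod.stdAddChar a * v (s + 2)‖ ^ 2) =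
      ‖v (0 + 1) + ZMod.stdAddChar a * v (0 + 2)‖ ^ 2 + ‖v (1 + 1) + ZMod.stdAddChar a * v (1 + 2)‖ ^ 2 +
      ‖v (2 + 1) + ZMod.stdAddChar a * v (2 + 2)‖ ^ 2 from
      Fin.sum_univ_three (fun s : ZMod 3 => ‖v (s + 1) + ZMod.stdAddChar a * v (s + 2)‖ ^ 2)]
    unfold cnsq twAvg
    simp only [norm_div, Complex.norm_ofNat, div_pow]
    ring
  have hr : (∑ s : ZMod 3, ‖v s‖ ^ 2) = cnsq v := Fin.sum_univ_three (fun s : ZMod 3 => ‖v s‖ ^ 2)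
  rw [hl, hr] at h
  nlinarith [cnsq_nonneg v, sq_nonneg (Real.cos (Real.pi / (3 * p)))]

/-- CharDial sub-characteristic helper `rho_nonneg` (lens-6 g8 LAND package; see the module docstring). -/
theorem rho_nonneg : 0 ≤ Real.cos (Real.pi / (3 * p)) := by
  have hp2 : 2 ≤ p := (Fact.out : p.Prime).two_le
  have hpR : (2 : ℝ) ≤ p := by exact_mod_cast hp2
  apply Real.cos_nonneg_of_neg_pi_div_two_le_of_le
  · have : 0 ≤ Real.pi / (3 * p) := by positivity
    linarith [Real.pi_pos]
  · rw [div_le_div_iff₀ (by positivity) (by norm_num)]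
    nlinarith [Real.pi_pos]

/-- CharDial sub-characteristic helper `rho_lt_one` (lens-6 g8 LAND package; see the module docstring). -/
theorem rho_lt_one : Real.cos (Real.pi / (3 * p)) < 1 := by
  have hp2 : 2 ≤ p := (Fact.out : p.Prime).two_le
  have hpR : (2 : ℝ) ≤ p := by exact_mod_cast hp2
  have harg0 : 0 < Real.pi / (3 * p) := by positivity
  have harg1 : Real.pi / (3 * p) ≤ Real.pi / 2 := by
    rw [div_le_div_iff₀ (by positivity) (by norm_num)]
    nlinarith [Real.pi_pos]
  rw [← Real.cos_zero]
  exact Real.cos_lt_cos_of_nonneg_of_le_pi_div_two le_rfl harg1 harg0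

/-- **The group-peel inequality with the maximising residue vector** (`ρ = cos(π/3p)`, constant `3`). -/
theorem group_peel (hp3 : p ≠ 3) (c : ℕ) (D : JLinData p n) (G : Finset (Fin (n + 1))) :
    ∃ κ : Fin (n + 1) → ZMod p, (winCount c D.strat : ℝ) ≤
      3 * D.codeCost G (Real.cos (Real.pi / (3 * p))) * (2 : ℝ) ^ n + (winCount c (D.freezeAll G κ).strat : ℝ) := by
  classical
  obtain ⟨κ, hκ, hmax⟩ := Finset.exists_max_image (tSet p G)
    (fun κ => winCount c (D.freezeAll G κ).strat) ⟨0, zero_mem_tSet G⟩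
  refine ⟨κ, ?_⟩
  have hdef := group_defect_le rho_nonneg (site_contraction hp3) c D G
  have hsum : (∑ κ' ∈ tSet p G, (winCount c (D.freezeAll G κ').strat : ℝ)) ≤
      (p : ℝ) ^ G.card * (winCount c (D.freezeAll G κ).strat : ℝ) := by
    calc (∑ κ' ∈ tSet p G, (winCount c (D.freezeAll G κ').strat : ℝ))
        ≤ ∑ κ' ∈ tSet p G, (winCount c (D.freezeAll G κ).strat : ℝ) :=
          Finset.sum_le_sum fun κ' hκ' => by exact_mod_cast hmax κ' hκ'
      _ = (p : ℝ) ^ G.card * (winCount c (D.freezeAll G κ).strat : ℝ) := by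
          rw [Finset.sum_const, card_tSet, nsmul_eq_mul]; push_cast; ring
  have hp : (0 : ℝ) < (p : ℝ) ^ G.card := by
    have : (0 : ℝ) < p := by exact_mod_cast (Fact.out : p.Prime).pos
    positivity
  have key : (p : ℝ) ^ G.card * (winCount c D.strat : ℝ) ≤ (p : ℝ) ^ G.card *
      (3 * D.codeCost G (Real.cos (Real.pi / (3 * p))) * (2 : ℝ) ^ n + (winCount c (D.freezeAll G κ).strat : ℝ)) := by
    rw [mul_add]
    linarith
  exact le_of_mul_le_mul_left key hp

end GroupLaw

end Summit.QuantumAdvantage.AdviceFreeQNC0.JLinPeel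

end
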